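import Summits.FinalStateConjecture.FinalStateConjecture.Statement
import Literature.Geometry.Lorentzian.CausalFutureProofs
import Literature.Geometry.Lorentzian.KerrConvergenceProofs
import Literature.Geometry.Lorentzian.MinkowskiGlobalHyperbolicity

/-!
# Coordinate lines through charts are causal curves; the no-hole case of `SeamedChartsExhaust`
# (support for crux `stmt-FinalStateConjecture-13551`, route `StarvedNecks`, from its standing disprover)

The crux `SeamedChartsExhaust` (`Theses/StarvedNecks.lean`) is the implication
"`HonestCore(d, R₀)` ∧ `SEAMED(d, R, R₀)` ∧ `O = J⁺(ι X) ∩ I⁻(d.charted)` ⇒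
`Summit.FinalStateConjecture.HasExhaustiveCharts d`" for `C²` final-state decompositions `d`. Its
intended proof (route docstring, (α)/(β)) FLOWS points of `O` along coordinate lines of the charts —
`e₀`-lines of the flat chart, `Λᵢe₀`-lines of the hole charts — and then locates the first entry of a
causal curve into the certified late region. This file provides, sorry-free:

* `line_mem_causalFuture` — the flow lemma in the generality every step of (α) needs: for a smooth
  chart `Φ : U → 𝓢` on an open `U ⊆ E4`, a direction `v`, and a segment `σ ↦ y + σ v` lying in `U` for
  `σ ∈ [−ε, s + ε]` along which `dΦ(v)` is future-directed causal on `[0, s]`, one has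
  `Φ(y) ≤ Φ(y + s v)` (`J⁺`). The parameter is clamped to `[−ε, s + ε]` so that the curve is globally
  defined and differentiable on the CLOSED interval `[0, s]`, as `IsFutureCausalCurveOn` demands; the
  velocity is computed through `Subtype.val` (`OpensChart.mfderiv_subtypeVal_apply`).
* `hasExhaustiveCharts_of_N_eq_zero` — the NO-HOLE CASE of the crux, proved at spacetime level: if
  `d.N = 0`, `O ⊆ I⁻(d.charted)`, `HonestCore` (d) (future-oriented flat chart) and the `N = 0` form of
  SEAMED (11) (images of the closed flat-late slabs `{x⁰ ≥ τ'}`, `τ' > τ₀`, are closed) hold, then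
  `HasExhaustiveCharts d`. Proof = the `N = 0` shadow of (α)/(β): `p ≪ Φ(y)`; if `y⁰ ≤ τ₁` flow up to the
  flat slab `{x⁰ = τ₁}`; if `y⁰ > τ₁` take the last parameter of the timelike curve from `Φ(y)` to `p` in
  `closure (Φ '' {x⁰ > τ₁})` — by (11) a flat point with `x⁰ ≥ τ₁`, and `x⁰ > τ₁` contradicts maximality
  (open embedding) or `p ∉ certifiedLate`, so it lies on the slab and `p ≤` it. CONSEQUENCE recorded for
  the refuter ledger: a counterexample to the crux needs a hole chart (`N ≥ 1`).

References: B. O'Neill, *Semi-Riemannian geometry*, Academic Press 1983, Ch. 14, pp. 402–403 (`J⁺`,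
transitivity `causalFuture_causalFuture_eq` in the tree); J. M. Lee, *Introduction to Smooth Manifolds*,
2nd ed. 2013, Prop. 3.9 (differential of the inclusion of an open submanifold); M. Dafermos,
G. Holzegel, I. Rodnianski, M. Taylor, arXiv:2104.08222, §1 (late-time charts).
-/

noncomputable section

open TopologicalSpace Manifold Filter Topology Set Function
open scoped ContDiff Topology ENNReal Manifold

namespace Summit.FinalStateConjecture.FinalStateConjecture.Theorems.SeamedChartsExhaust.Negative

open Literature.Geometry.Lorentzian LorentzianMetric

section Flow

variable {𝓢 : Spacetime.{0} 4}

/-- **Coordinate lines through a chart are causal curves.** Let `Φ : U → 𝓢` be smooth on an open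
`U ⊆ E4`, `v ∈ E4`, and suppose the segment `σ ↦ y + σ v`, `σ ∈ [−ε, s + ε]`, lies in `U` and `dΦ(v)` is
future-directed causal along `σ ∈ [0, s]`. Then `Φ(y) ≤ Φ(y + s v)`. (The parameter is clamped to
`[−ε, s + ε]` to obtain a globally defined curve that is differentiable on the CLOSED interval `[0, s]`,
as the tree's `IsFutureCausalCurveOn` demands.) O'Neill 1983, Ch. 14, p. 402. [folklore] -/
theorem line_mem_causalFuture {U : Opens E4} {Φ : U → 𝓢.carrier}
    (hΦ : ContMDiff 𝓘(ℝ, E4) (𝓡 4) ∞ Φ) (v y : E4) (hy : y ∈ U) {s ε : ℝ} (hs : 0 ≤ s) (hε : 0 < ε)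
    (hmem : ∀ σ ∈ Icc (-ε) (s + ε), y + σ • v ∈ U)
    (hfut : ∀ z : U, z.1 ∈ (fun σ : ℝ ↦ y + σ • v) '' Icc 0 s →
      𝓢.timeOrientation.IsFutureDirected (mfderiv 𝓘(ℝ, E4) (𝓡 4) Φ z v)) :
    Φ ⟨y + s • v, hmem s ⟨by linarith, by linarith⟩⟩ ∈
      𝓢.metric.causalFuture 𝓢.timeOrientation {Φ ⟨y, hy⟩} := by
  rcases hs.eq_or_lt with hs0 | hs'
  · subst hs0
    have : (⟨y + (0 : ℝ) • v, hmem 0 ⟨by linarith, by linarith⟩⟩ : U) = ⟨y, hy⟩ := Subtype.ext (by simp)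
    rw [this]
    exact Or.inl rfl
  -- clamp the parameter
  set c : ℝ → ℝ := fun σ ↦ max (-ε) (min σ (s + ε)) with hc
  have hcmem : ∀ σ, c σ ∈ Icc (-ε) (s + ε) := fun σ ↦
    ⟨le_max_left _ _, max_le (by linarith) (min_le_right _ _)⟩
  have hcid : ∀ σ ∈ Ioo (-ε) (s + ε), c σ = σ := fun σ hσ ↦ by
    simp only [hc]
    rw [min_eq_left hσ.2.le, max_eq_right hσ.1.le]
  set ι : ℝ → U := fun σ ↦ ⟨y + c σ • v, hmem (c σ) (hcmem σ)⟩ with hι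
  have hιval : ∀ σ, (ι σ).1 = y + c σ • v := fun σ ↦ rfl
  set γ : ℝ → 𝓢.carrier := fun σ ↦ Φ (ι σ) with hγ
  have hι0 : ι 0 = ⟨y, hy⟩ := Subtype.ext (by
    rw [hιval, hcid 0 ⟨by linarith, by linarith⟩]; simp)
  have hιs : ι s = ⟨y + s • v, hmem s ⟨by linarith, by linarith⟩⟩ := Subtype.ext (by
    rw [hιval, hcid s ⟨by linarith, by linarith⟩])
  refine Or.inr ⟨Φ ⟨y, hy⟩, rfl, γ, 0, s, hs', ?_, ?_, ?_⟩
  · intro t ht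
    have htI : t ∈ Ioo (-ε) (s + ε) := ⟨by linarith [ht.1], by linarith [ht.2]⟩
    have hev : ∀ᶠ σ in 𝓝 t, c σ = σ :=
      Filter.eventually_of_mem (isOpen_Ioo.mem_nhds htI) fun σ hσ ↦ hcid σ hσ
    have hval : (Subtype.val ∘ ι) =ᶠ[𝓝 t] fun σ : ℝ ↦ y + σ • v :=
      hev.mono fun σ hσ ↦ by simp only [Function.comp_apply, hιval, hσ]
    have haff : ContMDiff 𝓘(ℝ, ℝ) 𝓘(ℝ, E4) ∞ (fun σ : ℝ ↦ y + σ • v) :=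
      (contDiff_const.add (contDiff_id.smul contDiff_const)).contMDiff
    have hιs' : ContMDiffAt 𝓘(ℝ, ℝ) 𝓘(ℝ, E4) ∞ ι t := by
      rw [← ContMDiffAt.subtypeVal_comp_iff]
      exact haff.contMDiffAt.congr_of_eventuallyEq hval
    have hιd : MDifferentiableAt 𝓘(ℝ, ℝ) 𝓘(ℝ, E4) ι t := hιs'.mdifferentiableAt (by simp)
    have hΦd : MDifferentiableAt 𝓘(ℝ, E4) (𝓡 4) Φ (ι t) := hΦ.mdifferentiableAt (by simp)
    have hγd : MDifferentiableAt 𝓘(ℝ, ℝ) (𝓡 4) γ t := hΦd.comp t hιd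
    -- the velocity of `ι` is `v`
    have hder : HasDerivAt (fun σ : ℝ ↦ y + σ • v) v t := by
      simpa using ((hasDerivAt_id t).smul_const v).const_add y
    have h3 : mfderiv 𝓘(ℝ, ℝ) 𝓘(ℝ, E4) (fun σ : ℝ ↦ y + σ • v) t (1 : ℝ) = v := by
      rw [mfderiv_eq_fderiv]
      change fderiv ℝ (fun σ : ℝ ↦ y + σ • v) t 1 = v
      rw [hder.hasFDerivAt.fderiv]
      simp
    have hvι : mfderiv 𝓘(ℝ, ℝ) 𝓘(ℝ, E4) ι t (1 : ℝ) = v := by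
      have h1 : mfderiv 𝓘(ℝ, ℝ) 𝓘(ℝ, E4) (Subtype.val ∘ ι) t =
          (mfderiv 𝓘(ℝ, E4) 𝓘(ℝ, E4) (Subtype.val : U → E4) (ι t)).comp
            (mfderiv 𝓘(ℝ, ℝ) 𝓘(ℝ, E4) ι t) :=
        mfderiv_comp t
          ((contMDiff_subtype_val : ContMDiff 𝓘(ℝ, E4) 𝓘(ℝ, E4) ∞ (Subtype.val : U → E4)).mdifferentiableAt
            (by simp)) hιd
      have h2 : mfderiv 𝓘(ℝ, ℝ) 𝓘(ℝ, E4) (Subtype.val ∘ ι) t =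
          mfderiv 𝓘(ℝ, ℝ) 𝓘(ℝ, E4) (fun σ : ℝ ↦ y + σ • v) t := hval.mfderiv_eq
      have h4 : (mfderiv 𝓘(ℝ, E4) 𝓘(ℝ, E4) (Subtype.val : U → E4) (ι t))
          ((mfderiv 𝓘(ℝ, ℝ) 𝓘(ℝ, E4) ι t) (1 : ℝ)) =
          (mfderiv 𝓘(ℝ, ℝ) 𝓘(ℝ, E4) (fun σ : ℝ ↦ y + σ • v) t) (1 : ℝ) := by
        have := congrArg (fun L ↦ L (1 : ℝ)) h1
        rw [h2] at this
        exact this.symm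
      rw [h3, OpensChart.mfderiv_subtypeVal_apply] at h4
      exact h4
    have hvel : velocity (𝓡 4) γ t = mfderiv 𝓘(ℝ, E4) (𝓡 4) Φ (ι t) v := by
      unfold velocity
      rw [show γ = Φ ∘ ι from rfl, mfderiv_comp t hΦd hιd]
      show (mfderiv 𝓘(ℝ, E4) (𝓡 4) Φ (ι t)) ((mfderiv 𝓘(ℝ, ℝ) 𝓘(ℝ, E4) ι t) (1 : ℝ)) = _
      rw [hvι]
    refine ⟨hγd, ?_⟩
    rw [hvel]
    refine hfut (ι t) ⟨c t, ?_, (hιval t).symm⟩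
    rw [hcid t htI]
    exact ht
  · show Φ (ι 0) = Φ ⟨y, hy⟩
    rw [hι0]
  · show Φ (ι s) = Φ ⟨y + s • v, hmem s ⟨by linarith, by linarith⟩⟩
    rw [hιs]

/-- The `N = 0` case of the core, PROVED: no hole, `O ⊆ I⁻(d.charted)`, `HonestCore` (d) and SEAMED (11)
(in its `N = 0` form: the images of the closed flat-late slabs `{x⁰ ≥ τ'}`, `τ' > τ₀`, are closed) imply
`HasExhaustiveCharts d`. In particular a counterexample to `SeamedChartsExhaust` needs `N ≥ 1`.
O'Neill 1983, Ch. 14, pp. 402–403. [folklore] -/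
theorem hasExhaustiveCharts_of_N_eq_zero {O : Set 𝓢.carrier} {k : ℕ}
    (d : FinalStateDecomposition 𝓢 O k) (hN : d.N = 0)
    (hO : O ⊆ 𝓢.metric.chronologicalPast 𝓢.timeOrientation d.charted)
    (hfut : ∀ y : d.flatDomain, d.τ₀ < y.1 0 →
      𝓢.timeOrientation.IsFutureDirected (mfderiv 𝓘(ℝ, E4) (𝓡 4) d.flatChart y (E4.basisVector 0)))
    (h11 : ∀ τ' : ℝ, d.τ₀ < τ' →
      closure (d.flatChart '' {y | τ' ≤ y.1 0}) ⊆ d.flatChart '' {y | τ' ≤ y.1 0}) :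
    HasExhaustiveCharts d := by
  haveI : IsEmpty (Fin d.N) := ⟨fun i ↦ (Fin.cast hN i).elim0⟩
  have hn : (2 : WithTop ℕ∞) ≤ ((⊤ : ℕ∞) : WithTop ℕ∞) := WithTop.coe_le_coe.mpr le_top
  set Φ := d.flatChart with hΦdef
  set B := Minkowski.backgroundOn d.flatDomain with hB
  -- `HasExhaustiveCharts` (Statement rev. 2026-08-16): radii `R := 0`; the two per-hole clauses (growth
  -- of `R i`, `Cᵏ` convergence on the truncated slabs) are vacuous for `N = 0`.
  refine ⟨fun _ _ ↦ 0, fun i ↦ (Fin.cast hN i).elim0, fun i ↦ (Fin.cast hN i).elim0,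
    fun τ₁ hτ₁ p hp ↦ ?_⟩
  obtain ⟨hpO, hpF⟩ := hp
  have hch : d.charted = Φ '' B.lateRegion d.τ₀ := by
    rw [FinalStateDecomposition.charted, iUnion_of_empty, union_empty]; rfl
  have hCL : certifiedLate d (fun _ _ ↦ 0) τ₁ = Φ '' B.lateRegion τ₁ := by
    rw [certifiedLate, iUnion_of_empty, union_empty]
  have hCS : certifiedSlab d (fun _ _ ↦ 0) τ₁ = Φ '' B.timeSlab τ₁ := by
    rw [certifiedSlab, iUnion_of_empty, union_empty]
  rw [hCL] at hpF
  rw [hCS]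
  obtain ⟨q, hq, γ, a, b, hab, hγ, hγa, hγb⟩ := hO hpO
  rw [hch] at hq
  obtain ⟨y, hy, rfl⟩ := hq
  have hy' : d.τ₀ < y.1 0 := hy
  -- `J⁻` bookkeeping
  have Jmono : ∀ {w : 𝓢.carrier}, w ∈ Φ '' B.timeSlab τ₁ →
      𝓢.metric.causalPast 𝓢.timeOrientation {w} ⊆
        𝓢.metric.causalPast 𝓢.timeOrientation (Φ '' B.timeSlab τ₁) :=
    fun hw ↦ causalFuture_mono (singleton_subset_iff.mpr hw)
  have Jtrans : ∀ {u w x : 𝓢.carrier}, u ∈ 𝓢.metric.causalPast 𝓢.timeOrientation {w} →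
      w ∈ 𝓢.metric.causalPast 𝓢.timeOrientation {x} → u ∈ 𝓢.metric.causalPast 𝓢.timeOrientation {x} := by
    intro u w x hu hw
    have : u ∈ 𝓢.metric.causalPast 𝓢.timeOrientation (𝓢.metric.causalPast 𝓢.timeOrientation {x}) :=
      causalFuture_mono (singleton_subset_iff.mpr hw) hu
    rwa [LorentzianMetric.causalPast, LorentzianMetric.causalPast,
      causalFuture_causalFuture_eq hn] at this
  rcases le_or_gt (y.1 0) τ₁ with hle | hlt
  · -- Case A: flow from `y` up to the slab `{x⁰ = τ₁}`
    set s := τ₁ - y.1 0 with hs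
    have hs0 : 0 ≤ s := by linarith
    set ε := (y.1 0 - d.τ₀) / 2 with hεdef
    have hε : 0 < ε := by rw [hεdef]; linarith
    have hmem : ∀ σ ∈ Icc (-ε) (s + ε), y.1 + σ • E4.basisVector 0 ∈ d.flatDomain := by
      intro σ hσ
      apply d.setOf_lt_excision_subset_flatDomain
      refine ⟨?_, fun i ↦ (Fin.cast hN i).elim0⟩
      show d.τ₀ < (y.1 + σ • E4.basisVector 0) 0
      have h1 : -ε ≤ σ := hσ.1
      simp
      linarith
    have hflow := line_mem_causalFuture d.isLateChart_flat.contMDiff (E4.basisVector 0) y.1 y.2 hs0 hε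
      hmem (by
        rintro z ⟨σ, hσ, hzσ⟩
        apply hfut
        show d.τ₀ < z.1 0
        rw [← hzσ]
        have h1 : 0 ≤ σ := hσ.1
        simp
        linarith)
    have hz : (⟨y.1 + s • E4.basisVector 0, hmem s ⟨by linarith, by linarith⟩⟩ : d.flatDomain) ∈
        B.timeSlab τ₁ := by
      show (y.1 + s • E4.basisVector 0) 0 = τ₁
      simp [hs]
    have hpy : p ∈ 𝓢.metric.causalPast 𝓢.timeOrientation {Φ y} :=
      Or.inr ⟨Φ y, rfl, γ, a, b, hab, hγ.isFutureCausalCurveOn, hγa, hγb⟩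
    exact Jmono (mem_image_of_mem Φ hz) (Jtrans hpy (mem_causalPast_of_mem_causalFuture hflow))
  · -- Case B: last parameter in the closure of the certified-late region
    have hCLopen : IsOpen (Φ '' B.lateRegion τ₁) := by
      have hemb := d.isLateChart_flat.isOpenEmbedding
      have hsub : Φ '' B.lateRegion τ₁ =
          (B.lateRegion d.τ₀).restrict Φ '' {z : B.lateRegion d.τ₀ | τ₁ < z.1.1 0} := by
        ext w
        constructor
        · rintro ⟨z, hz, rfl⟩
          have hz' : τ₁ < z.1 0 := hz
          exact ⟨⟨z, show d.τ₀ < z.1 0 by linarith⟩, hz', rfl⟩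
        · rintro ⟨z, hz, rfl⟩
          exact ⟨z.1, hz, rfl⟩
      rw [hsub]
      refine hemb.isOpenMap _ ?_
      exact isOpen_lt continuous_const
        ((PiLp.continuous_apply 2 _ 0).comp (continuous_subtype_val.comp continuous_subtype_val))
    -- continuity of γ on [a, b]
    have hγcont : ContinuousOn γ (Icc a b) := fun t ht ↦
      (hγ.isFutureCausalCurveOn.continuousAt ht).continuousWithinAt
    set S : Set ℝ := Icc a b ∩ γ ⁻¹' closure (Φ '' B.lateRegion τ₁) with hSdef
    have hSclosed : IsClosed S := hγcont.preimage_isClosed_of_isClosed isClosed_Icc isClosed_closure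
    have haS : a ∈ S := ⟨left_mem_Icc.mpr hab.le, by
      show γ a ∈ closure (Φ '' B.lateRegion τ₁)
      rw [hγa]; exact subset_closure ⟨y, hlt, rfl⟩⟩
    have hSbdd : BddAbove S := ⟨b, fun t ht ↦ ht.1.2⟩
    set t₀ := sSup S with ht₀
    have ht₀S : t₀ ∈ S := hSclosed.csSup_mem ⟨a, haS⟩ hSbdd
    have ht₀b : t₀ ≤ b := ht₀S.1.2
    -- the point γ t₀ is flat-charted with flat time ≥ τ₁
    have hsub' : B.lateRegion τ₁ ⊆ {z : d.flatDomain | τ₁ ≤ z.1 0} := fun z hz ↦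
      show τ₁ ≤ z.1 0 from le_of_lt hz
    have hzcl : γ t₀ ∈ closure (Φ '' {z : d.flatDomain | τ₁ ≤ z.1 0}) :=
      closure_mono (image_mono hsub') ht₀S.2
    obtain ⟨z, hz, hγz⟩ := h11 τ₁ hτ₁ hzcl
    have hz' : τ₁ ≤ z.1 0 := hz
    rcases hz'.eq_or_lt with hzeq | hzlt
    · -- on the slab: p ≤ γ t₀
      have hslab : γ t₀ ∈ Φ '' B.timeSlab τ₁ := ⟨z, hzeq.symm, hγz⟩
      rcases ht₀b.eq_or_lt with htb | htb
      · -- t₀ = b: p itself is on the slab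
        rw [htb, hγb] at hslab
        exact subset_causalPast _ _ _ hslab
      · refine Jmono hslab (Or.inr ⟨γ t₀, rfl, γ, t₀, b, htb, ?_, rfl, hγb⟩)
        exact (hγ.mono (Icc_subset_Icc ht₀S.1.1 le_rfl)).isFutureCausalCurveOn
    · -- strictly later than τ₁: γ t₀ is certified-late, contradiction with maximality of t₀
      exfalso
      have hin : γ t₀ ∈ Φ '' B.lateRegion τ₁ := ⟨z, hzlt, hγz⟩
      rcases ht₀b.eq_or_lt with htb | htb
      · apply hpF
        rw [← hγb, ← htb]
        exact hin
      · -- γ stays in the open set a little after t₀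
        have hct : ContinuousAt γ t₀ := hγ.isFutureCausalCurveOn.continuousAt ht₀S.1
        have hev : ∀ᶠ t in 𝓝 t₀, γ t ∈ Φ '' B.lateRegion τ₁ := hct (hCLopen.mem_nhds hin)
        obtain ⟨δ, hδ, hball⟩ := Metric.eventually_nhds_iff.mp hev
        set t₁ := min (t₀ + δ / 2) b with ht₁
        have ht₁gt : t₀ < t₁ := lt_min (by linarith) htb
        have ht₁S : t₁ ∈ S := by
          refine ⟨⟨by linarith [ht₀S.1.1], min_le_right _ _⟩, subset_closure (hball ?_)⟩
          rw [Real.dist_eq, abs_lt]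
          constructor <;> linarith [min_le_left (t₀ + δ / 2) b]
        have := le_csSup hSbdd ht₁S
        linarith

end Flow

end Summit.FinalStateConjecture.FinalStateConjecture.Theorems.SeamedChartsExhaust.Negative

end
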